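import Literature.NumberTheory.EllipticCurves.PeriodIndexKummerPhi
import HarnessLib

/-!
# Coordinates of the norm cocycles `Σ_x (s x)·Φ(a, b)` on a decomposition group
# (Clark–Sharif 2010, §3.5 Cor. 17 and Lemma 18, pointwise form)

Topic `NumberTheory/EllipticCurves`; theorems only. Companion of `PeriodIndexKummerIndex`
(`index_resH1Hom_coresH1_kummerPhi_sub_eq_sq`), whose local hypotheses concern the values on a
decomposition group `D_𝔓 ≤ 𝔤_k` of the cocycles
`Θ(a, b) = Σ_{x ∈ 𝔤_K/𝔤_k} (s x) · Φ(a, b)` (`= res cores Φ(a, b)`, Lemma 15 / Cor. 17). Here we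
compute these values POINTWISE from the Kummer characters of the conjugates `σ a, σ b`
(`conjCocycle_kummerPhiCocycle_apply`, Prop. 16), in the three situations produced by
Clark–Sharif's conditions (SC3′)–(SC4′):

* `sum_conjCocycle_kummerPhiCocycle_apply_eq_zero`: if all the characters `f_{σ_x a}, f_{σ_x b}`
  vanish at `n`, so does `Θ(a, b)(n)` ((SC3′): the far pair is a `P`-th power locally);
* `sum_conjCocycle_kummerPhiCocycle_apply_of_forall_ne`: if they vanish at `n` for all
  non-identity cosets, `Θ(a, b)(n) = ρ(f_a(n), f_b(n))` (the conjugates `σ π`, `σ ≠ 1`, are units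
  at `v`, `σ π' ∈ K_v^{×P}`; on the identity coset the twist is trivial,
  `conjCocycle_apply_of_mem_of_trivial`);
* `sum_conjCocycle_kummerPhiCocycle_mul_apply`: `Θ` is multiplicative in `(a, b)`;
* `isUnit_add_of_not_isUnit` and `exists_kummer_pair_isUnit`: **Lemma 18's dichotomy** — in
  `ℤ/pⁿ` a non-unit plus a unit is a unit, so with `θ = Φ(π, 1)` or `Φ(π, π')` the second
  coordinate at Frobenius is a unit as soon as `f_{π'}(φ)` is ("the order of `π'` in
  `K_v^×/K_v^{×P}` is `P`", (SC4′)).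

## References

* P. L. Clark, S. Sharif, *Period, index and potential Ш*, Algebra & Number Theory 4 (2010)
  151–174, §3.5 (Prop. 16, Cor. 17, Lemma 18) (`ClarkSharif2010`; arXiv:0811.3019 read).
-/

noncomputable section

open scoped Classical

universe u

namespace Literature.NumberTheory.EllipticCurves

open GaloisRepresentations Field

/-! ### `ℤ/pⁿ`: a non-unit plus a unit is a unit -/

/-- In `ℤ/Pℤ` with `P = pⁿ` a prime power, units are the classes prime to `p`; hence a
non-unit plus a unit is a unit (Clark–Sharif, proof of Lemma 18: "since `P` is a prime power,
the order strictly divides `P`" … "This shows `⟨cc′, dd′⟩_v` has exact order `P`"). [folklore] -/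
theorem isUnit_add_of_not_isUnit {P p n : ℕ} [NeZero P] (hp : p.Prime) (hP : P = p ^ n)
    {u w : ZMod P} (hu : IsUnit u) (hw : ¬IsUnit w) : IsUnit (w + u) := by
  have hn : 0 < n := by
    rcases Nat.eq_zero_or_pos n with rfl | h
    · exfalso
      rw [pow_zero] at hP
      subst hP
      exact hw (isUnit_of_subsingleton w)
    · exact h
  have hcop : ∀ a : ℕ, a.Coprime P ↔ ¬p ∣ a := fun a ↦ by
    rw [hP, Nat.coprime_pow_right_iff hn, Nat.coprime_comm, hp.coprime_iff_not_dvd]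
  have key : ∀ x : ZMod P, IsUnit x ↔ ¬p ∣ x.val := by
    intro x
    conv_lhs => rw [← ZMod.natCast_zmod_val x]
    rw [ZMod.isUnit_iff_coprime]
    exact hcop _
  rw [key] at hu hw ⊢
  replace hw := not_not.mp hw
  intro h
  apply hu
  have hPp : p ∣ P := by rw [hP]; exact dvd_pow_self p hn.ne'
  have h1 : p ∣ (w.val + u.val) % P := by rw [← ZMod.val_add]; exact h
  have h2 : p ∣ w.val + u.val := by
    have := (Nat.dvd_mod_iff hPp).mp h1
    exact this
  exact (Nat.dvd_add_right hw).mp h2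

/-! ### Values of `Σ_x (s x)·Φ(a, b)` -/

section Coords

variable {K : Type u} [Field K] {k : IntermediateField K (AlgebraicClosure K)} {P : ℕ} [NeZero P]
  {ζ : AlgebraicClosure K} [Normal K k] [(fixingGal k).Normal]
  {M : Type u} [AddCommGroup M] [DistribMulAction (absoluteGaloisGroup K) M]
  [TopologicalSpace M] [DiscreteTopology M]

omit [Normal K k] in
/-- On the identity coset the twist is trivial: for `c ∈ 𝔤_k` acting trivially on `M` and a
cocycle `θ` of `𝔤_k` (a homomorphism), `(c · θ)(n) = θ(c⁻¹ n c) = θ(n)`. [folklore] -/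
theorem conjCocycle_apply_of_mem_of_trivial (htriv : ∀ (n : fixingGal k) (m : M), n • m = m)
    {c : absoluteGaloisGroup K} (hc : c ∈ fixingGal k)
    (θ : contOneCocycles (discreteTopRep (fixingGal k) M)) (n : fixingGal k) :
    (conjCocycle (fixingGal k) c θ).1 n = θ.1 n := by
  have hhom : ∀ a b : fixingGal k, θ.1 (a * b) = θ.1 a + θ.1 b := fun a b ↦ by
    rw [θ.2 a b]
    change θ.1 a + a • θ.1 b = _
    rw [htriv]
  have h1 : θ.1 1 = 0 := by simpa using hhom 1 1
  have hinv : ∀ a : fixingGal k, θ.1 a⁻¹ = -θ.1 a := fun a ↦ by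
    have h := hhom a⁻¹ a
    rw [inv_mul_cancel, h1] at h
    exact (neg_eq_of_add_eq_zero_left h.symm).symm
  rw [conjCocycle_apply_of_trivial]
  have e : (⟨c⁻¹ * n * c, conj_mem_of_normal (fixingGal k) c n⟩ : fixingGal k) =
      (⟨c, hc⟩ : fixingGal k)⁻¹ * n * ⟨c, hc⟩ := rfl
  rw [e, show c • θ.1 ((⟨c, hc⟩ : fixingGal k)⁻¹ * n * ⟨c, hc⟩) =
      (⟨c, hc⟩ : fixingGal k) • θ.1 ((⟨c, hc⟩ : fixingGal k)⁻¹ * n * ⟨c, hc⟩) from rfl, htriv, hhom, hhom,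
    hinv]
  abel

/-- **The far pair: `Θ(a, b)(n) = 0` when all conjugate Kummer characters vanish at `n`**
((SC3′) at the conjugates of `v`: `σ a, σ b ∈ K_v^{×P}`). [cite: ClarkSharif2010, §3.4 (SC3′) and Cor. 17] -/
theorem sum_conjCocycle_kummerPhiCocycle_apply_eq_zero [Fintype (absoluteGaloisGroup K ⧸ fixingGal k)]
    (hζ : IsPrimitiveRoot ζ P) (hζk : ζ ∈ k) (htriv : ∀ (n : fixingGal k) (m : M), n • m = m)
    (ρ : ZMod P × ZMod P →+ M) (s : absoluteGaloisGroup K ⧸ fixingGal k → absoluteGaloisGroup K)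
    (a b : (↥k)ˣ) (n : fixingGal k)
    (h : ∀ x, unitChar P ζ (galUnit (s x) a) n = 0 ∧ unitChar P ζ (galUnit (s x) b) n = 0) :
    (∑ x, conjCocycle (fixingGal k) (s x) (kummerPhiCocycle hζ hζk htriv ρ a b)).1 n = 0 := by
  rw [sum_apply_val]
  refine Finset.sum_eq_zero fun x _ ↦ ?_
  rw [conjCocycle_kummerPhiCocycle_apply, (h x).1, (h x).2, mul_zero, Prod.mk_zero_zero, map_zero,
    smul_zero]

/-- **The near pair: `Θ(a, b)(n) = ρ(f_a(n), f_b(n))` when the conjugate characters of the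
non-identity cosets vanish at `n`** (for `n` in the inertia group at `v`: `σ π` is a `v`-unit for
`σ ≠ 1`, and `σ π' ∈ K_v^{×P}` by (SC4′); on the identity coset `s x₀ ∈ 𝔤_k` the twist is
trivial). [cite: ClarkSharif2010, §3.5 (Cor. 17, Lemma 18)] -/
theorem sum_conjCocycle_kummerPhiCocycle_apply_of_forall_ne
    [Fintype (absoluteGaloisGroup K ⧸ fixingGal k)]
    (hζ : IsPrimitiveRoot ζ P) (hζk : ζ ∈ k) (htriv : ∀ (n : fixingGal k) (m : M), n • m = m)
    (ρ : ZMod P × ZMod P →+ M) (s : absoluteGaloisGroup K ⧸ fixingGal k → absoluteGaloisGroup K)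
    {x₀ : absoluteGaloisGroup K ⧸ fixingGal k} (hx₀ : s x₀ ∈ fixingGal k)
    (a b : (↥k)ˣ) (n : fixingGal k)
    (h : ∀ x, x ≠ x₀ → unitChar P ζ (galUnit (s x) a) n = 0 ∧ unitChar P ζ (galUnit (s x) b) n = 0) :
    (∑ x, conjCocycle (fixingGal k) (s x) (kummerPhiCocycle hζ hζk htriv ρ a b)).1 n =
      ρ (unitChar P ζ a n, unitChar P ζ b n) := by
  rw [sum_apply_val, ← Finset.add_sum_erase _ _ (Finset.mem_univ x₀),
    conjCocycle_apply_of_mem_of_trivial htriv hx₀, kummerPhiCocycle_apply]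
  rw [Finset.sum_eq_zero fun x hx ↦ ?_, add_zero]
  have hx' : x ≠ x₀ := Finset.ne_of_mem_erase hx
  rw [conjCocycle_kummerPhiCocycle_apply, (h x hx').1, (h x hx').2, mul_zero, Prod.mk_zero_zero,
    map_zero, smul_zero]

omit [Normal K k] in
/-- **`Θ` is multiplicative in the pair**: `Θ(a a', b b')(n) = Θ(a, b)(n) + Θ(a', b')(n)`
(`Φ` is multiplicative, `kummerPhiCocycle_mul`, and conjugation is additive). [folklore] -/
theorem sum_conjCocycle_kummerPhiCocycle_mul_apply [Fintype (absoluteGaloisGroup K ⧸ fixingGal k)]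
    (hζ : IsPrimitiveRoot ζ P) (hζk : ζ ∈ k) (htriv : ∀ (n : fixingGal k) (m : M), n • m = m)
    (ρ : ZMod P × ZMod P →+ M) (s : absoluteGaloisGroup K ⧸ fixingGal k → absoluteGaloisGroup K)
    (a a' b b' : (↥k)ˣ) (n : fixingGal k) :
    (∑ x, conjCocycle (fixingGal k) (s x) (kummerPhiCocycle hζ hζk htriv ρ (a * a') (b * b'))).1 n =
      (∑ x, conjCocycle (fixingGal k) (s x) (kummerPhiCocycle hζ hζk htriv ρ a b)).1 n +
        (∑ x, conjCocycle (fixingGal k) (s x) (kummerPhiCocycle hζ hζk htriv ρ a' b')).1 n := by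
  rw [sum_apply_val, sum_apply_val, sum_apply_val, ← Finset.sum_add_distrib]
  refine Finset.sum_congr rfl fun x _ ↦ ?_
  rw [conjCocycle_apply, conjCocycle_apply, conjCocycle_apply, kummerPhiCocycle_mul hζ hζk,
    add_apply_val, smul_add]

/-- **Lemma 18's dichotomy.** Let `x₀` be the identity coset (`s x₀ ∈ 𝔤_k`), `φ ∈ 𝔤_k` (a
Frobenius at `v`), `π, π' ∈ kˣ` with: the conjugate characters `f_{σ_x π'}`, `x ≠ x₀`, vanish at
`φ` ((SC4′): `σ π' ∈ K_v^{×P}`) and `f_{π'}(φ)` is a unit ((SC4′): the order of `π'` in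
`K_v^×/K_v^{×P}` is `P`); `P = pⁿ`. If `Θ(π, 1)(φ) = ρ(c₁, c₂)` then for `b = 1` or `b = π'` one
has `Θ(π, b)(φ) = ρ(c₁, c₂')` with `c₂'` a unit ("If `⟨c, d⟩` has order `P`, let `θ = Φ(π, 1)` …
Otherwise, let `θ = Φ(π, π′)`"). [cite: ClarkSharif2010, Lemma 18] -/
theorem exists_kummer_pair_isUnit [Fintype (absoluteGaloisGroup K ⧸ fixingGal k)]
    {p m : ℕ} (hp : p.Prime) (hP : P = p ^ m)
    (hζ : IsPrimitiveRoot ζ P) (hζk : ζ ∈ k) (htriv : ∀ (n : fixingGal k) (m : M), n • m = m)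
    (ρ : ZMod P × ZMod P →+ M) (s : absoluteGaloisGroup K ⧸ fixingGal k → absoluteGaloisGroup K)
    {x₀ : absoluteGaloisGroup K ⧸ fixingGal k} (hx₀ : s x₀ ∈ fixingGal k)
    (π π' : (↥k)ˣ) (φ : fixingGal k)
    (hconj : ∀ x, x ≠ x₀ → unitChar P ζ (galUnit (s x) π') φ = 0)
    (hunit : IsUnit (unitChar P ζ π' φ)) {c₁ c₂ : ZMod P}
    (hc : (∑ x, conjCocycle (fixingGal k) (s x) (kummerPhiCocycle hζ hζk htriv ρ π 1)).1 φ = ρ (c₁, c₂)) :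
    ∃ b : (↥k)ˣ, (b = 1 ∨ b = π') ∧ ∃ c₂' : ZMod P, IsUnit c₂' ∧
      (∑ x, conjCocycle (fixingGal k) (s x) (kummerPhiCocycle hζ hζk htriv ρ π b)).1 φ = ρ (c₁, c₂') := by
  by_cases hc₂ : IsUnit c₂
  · exact ⟨1, Or.inl rfl, c₂, hc₂, hc⟩
  · refine ⟨π', Or.inr rfl, c₂ + unitChar P ζ π' φ, isUnit_add_of_not_isUnit hp hP hunit hc₂, ?_⟩
    have h1 : (∑ x, conjCocycle (fixingGal k) (s x) (kummerPhiCocycle hζ hζk htriv ρ 1 π')).1 φ =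
        ρ (0, unitChar P ζ π' φ) := by
      rw [sum_conjCocycle_kummerPhiCocycle_apply_of_forall_ne hζ hζk htriv ρ s hx₀ 1 π' φ fun x hx ↦
        ⟨?_, hconj x hx⟩, unitChar_one_left hζ hζk]
      have e : galUnit (s x) (1 : (↥k)ˣ) = 1 := by
        rw [galUnit, map_one]
      rw [e, unitChar_one_left hζ hζk]
    have e : (π, π') = ((π * 1 : (↥k)ˣ), (1 * π' : (↥k)ˣ)) := by rw [mul_one, one_mul]
    rw [show kummerPhiCocycle hζ hζk htriv ρ π π' = kummerPhiCocycle hζ hζk htriv ρ (π * 1) (1 * π') by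
      rw [mul_one, one_mul], sum_conjCocycle_kummerPhiCocycle_mul_apply, hc, h1, ← map_add,
      Prod.mk_add_mk, add_zero]

end Coords

end Literature.NumberTheory.EllipticCurves
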